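import Literature.NumberTheory.Rogawski1990.CartanAlgebra      -- ★ `hermStar`, `cartanAlgebra`, `mem_cartanAlgebra_iff`; brings ★ `twistGram`, `unitaryGroup`, Mathlib eigenspaces ∕ `charpoly_toLin'`
import Mathlib.LinearAlgebra.Matrix.Basis
import HarnessLib

/-!
# R90-TF · S4 «Ch. 13.1–2», (DICT)(1) file F1 — THE SPLIT CARTAN ALGEBRA: for a unitary `γ` whose characteristic polynomial SPLITS with distinct roots of norm one,
# `(Z(γ), ⋆) ≅ (Kⁿ, σⁿ)` through an eigenframe (Rogawski 1990, §3.6 p. 30, type (1): `T ≅ (E¹)³`, `r′ = 3`; §3.5 Prop. 3.5.2 p. 29)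

Cell `hodgecm-mathlib`, crux H413 (`stmt-HodgeConjecture-24833`, lane `--supports … --as helper`), route of record `HCCMUnconditional` (no route verbs; count-neutral).
Programme R90-TF, section S4 = Rogawski Ch. 13.1–2 (base `R90-C131`), dealer K2E2-plan (g7): hand (DICT)(1) «`(E¹)³` TYPE» of K2E3-p12 (g10)'s stable-transport dictionary
`IsStableTransportDict` (★ p863911 `Theorems/R90S4StableTransportDict`), ruling «= GO» `R90/STATUS.md` 2026-09-05T01:10:20Z on the census `R90/R90-C131-p01/g2/CENSUS-DICT1-E1cubed.md`
(road = the H¹ ∕ Cartan-class road of Prop. 3.5.2 (a), ★ `exists_unitary_conj_iff_exists_norm_eq`); seat R90-C131-p01 (g2).  File F1 of the plan F1 → F2 (four classes) → F3 (members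
and transports).  THEOREMS ONLY (no `def`, no instance, no notation, no named fact, no `sorry`); ★-only imports + Mathlib.  GENERIC: any field `K` with an endomorphism `σ`, any
`σ`-hermitian invertible `H ∈ M_N(K)`, any `N` — the CM reading (`K = L ⊗ L⁺_v = L_w` at a non-split `v`, `σ = c ⊗ 1`, `H = Φ₃`) is by instantiation in F2.

## THE TYPE-(1) LETTER (dealer 01:10:20Z, for p12's and p27's rows verbatim)
«the characteristic polynomial of `γ₀` splits over `L_w` with `3` distinct roots in `E¹_w`»: `∃ μ : Fin 3 → L_w, Function.Injective μ ∧ (∀ i, σ (μ i) * μ i = 1) ∧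
charpoly γ₀ = ∏ i, (X − C (μ i))`.  (For `γ₀` unitary with split separable characteristic polynomial the roots come in pairs `{λ, σ(λ)⁻¹}`; «all in `E¹`» = every factor is
`τ`-stable, `r′ = 3` — it excludes the split Cartan `M` (type (0)), whose regular elements have roots `α, β, σ(α)⁻¹`.)

## THE MATHEMATICS
Let `γ = P·diag(μ)·P⁻¹` (an EIGENFRAME `P ∈ GL_N(K)`: it exists as soon as `charpoly γ = ∏ (X − μ_i)` with `μ` injective — eigenvectors for the `N` distinct roots are
linearly independent, §1).  Then (§2) the Cartan algebra `Z(γ) = {x : xγ = γx}` (★ `cartanAlgebra`) is `P·Diag·P⁻¹` (a matrix commuting with `diag(μ)`, `μ` injective, is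
diagonal).  If moreover `γ ∈ U(H)` and `σ(μ_i)μ_i = 1` (§3), unitarity `ᵗσ(γ) H γ = H` reads `diag(σμ)·Q·diag(μ) = Q` for the GRAM MATRIX OF THE FRAME `Q := ᵗσ(P) H P`
(★ `twistGram σ H P`), i.e. `Q_{ij}(μ_j − μ_i) = 0`: `Q` is DIAGONAL (the eigenlines are `H`-orthogonal; its entries `q_i = h(v_i, v_i)` are the line classes), and then the
adjoint involution `x⋆ = H⁻¹ ᵗσ(x) H` (★ `hermStar`) acts on `Z(γ)` COORDINATEWISE: `(P·diag(d)·P⁻¹)⋆ = P·diag(σ ∘ d)·P⁻¹` (§4).  Consequently (§5) the `⋆`-fixed elements of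
`Z(γ)` are the `P·diag(d)·P⁻¹` with `σ d = d`, the `⋆`-norms are `t⋆t = P·diag(σ(d_i) d_i)·P⁻¹`, and `det(P·diag(d)·P⁻¹) = ∏ d_i` — so
`(Z(γ)^⋆)ˣ ∕ N(Z(γ)ˣ) ≅ (K₀ˣ ∕ N Kˣ)^N` with `det ↦ ∏`, the input of F2's «four classes» (`N = 3`, `K₀ˣ∕NKˣ = ℤ∕2` at a non-split place: the realised classes are the
`ε ∈ (ℤ∕2)³` with `Σ ε = 0`). [Rogawski1990 §3.6 p. 30: «(1) `T ≅ (E¹)³` … `𝔇(T∕F) ≅ (ℤ∕2)²`»; §3.5 Prop. 3.5.2.]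

## CONTENTS (all generic)
* §1 `exists_units_conj_diagonal_of_charpoly_eq_prod` — eigenframe from a split characteristic polynomial with distinct roots.
* §2 `eq_diagonal_of_diagonal_mul_eq_mul_diagonal`, `mem_cartanAlgebra_conj_diagonal_iff` — `Z(P·diag(μ)·P⁻¹) = P·Diag·P⁻¹`.
* §3 `twistGram_eigenframe_apply_of_ne` ∕ `twistGram_eigenframe_eq_diagonal` — the Gram matrix of an eigenframe of a unitary `γ` with norm-one distinct roots is diagonal,
  with `σ`-fixed non-zero entries (`twistGram_eigenframe_apply_self`).
* §4 `hermStar_conj_diagonal` — `⋆` is `σ` on the coordinates.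
* §5 `hermStar_conj_diagonal_eq_self_iff`, `hermStar_mul_self_conj_diagonal`, `det_conj_diagonal_eq_prod`, `conj_diagonal_injective`.

HONEST LABEL: HC_CM is proved only modulo the 7 printed citations (2 remaining named inputs: hLiu418 = stmt-HodgeConjecture-24832, h413 = stmt-HodgeConjecture-24833) until rung 0
closes.  Generic linear algebra toward the type-(1) rows of one letter ((DICT)) behind ★ (B2-S) behind the OPEN (W-NP); discharges no named input.  REL ≠ ★ ≠ BUILT.

## References
* [Rogawski1990] J. D. Rogawski, *Automorphic Representations of Unitary Groups in Three Variables*, Ann. of Math. Stud. 123 (1990), §3.5 Prop. 3.5.2 p. 29, §3.6 pp. 30–31.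
* [HornJohnson2013] R. A. Horn, C. R. Johnson, *Matrix Analysis*, 2nd ed. (2013), Thm. 1.3.9 (distinct eigenvalues ⇒ diagonalisable), Thm. 3.2.4.2.
-/

set_option autoImplicit false
set_option linter.dupNamespace false

noncomputable section

open Polynomial Matrix
open scoped MatrixGroups
open Literature.NumberTheory.Rogawski1990
open Literature.AlgebraicGeometry.ShimuraVarieties (unitaryGroup mem_unitaryGroup_iff)

namespace Summit.HodgeConjecture.HodgeConjecture.R90.S4

section Generic

variable {K : Type*} [Field K] {N : ℕ}

/-! ## §1 Eigenframe of a matrix whose characteristic polynomial splits with distinct roots -/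

/-- **EIGENFRAME**: if `charpoly γ = ∏ᵢ (X − μᵢ)` with `μ` injective, then `γ = P·diag(μ)·P⁻¹` for some `P ∈ GL_N(K)` (the columns of `P` are eigenvectors for the `N`
distinct roots, linearly independent — Mathlib `Module.End.eigenvectors_linearIndependent'` — hence a basis of `Kᴺ`). [cite: HornJohnson2013, Thm. 1.3.9] -/
theorem exists_units_conj_diagonal_of_charpoly_eq_prod (γ : Matrix (Fin N) (Fin N) K) (μ : Fin N → K) (hinj : Function.Injective μ)
    (hχ : γ.charpoly = ∏ i, (X - C (μ i))) :
    ∃ P : GL (Fin N) K, γ = (P : Matrix (Fin N) (Fin N) K) * diagonal μ * ((P⁻¹ : GL (Fin N) K) : Matrix (Fin N) (Fin N) K) := by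
  classical
  -- an eigenvector for each root
  have hev : ∀ i, ∃ v : Fin N → K, Module.End.HasEigenvector (Matrix.toLin' γ) (μ i) v := by
    intro i
    refine Module.End.HasEigenvalue.exists_hasEigenvector ?_
    rw [Module.End.hasEigenvalue_iff_isRoot_charpoly, Matrix.charpoly_toLin', hχ, IsRoot, eval_prod]
    exact Finset.prod_eq_zero (Finset.mem_univ i) (by rw [eval_sub, eval_X, eval_C, sub_self])
  choose v hv using hev
  have hli : LinearIndependent K v := Module.End.eigenvectors_linearIndependent' (Matrix.toLin' γ) μ hinj v hv
  let b : Module.Basis (Fin N) K (Fin N → K) := basisOfPiSpaceOfLinearIndependent hli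
  have hb : ⇑b = v := coe_basisOfPiSpaceOfLinearIndependent hli
  let e : Module.Basis (Fin N) K (Fin N → K) := Pi.basisFun K (Fin N)
  -- the frame `P` (columns = the eigenvectors) and its inverse
  let P : GL (Fin N) K := ⟨e.toMatrix b, b.toMatrix e, e.toMatrix_mul_toMatrix_flip b, b.toMatrix_mul_toMatrix_flip e⟩
  have hP : ∀ i j, (P : Matrix (Fin N) (Fin N) K) i j = v j i := by
    intro i j
    change e.toMatrix b i j = v j i
    rw [Module.Basis.toMatrix_apply, hb, Pi.basisFun_repr]
  -- `γ P = P diag(μ)` column by column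
  have hγP : γ * (P : Matrix (Fin N) (Fin N) K) = (P : Matrix (Fin N) (Fin N) K) * diagonal μ := by
    ext i j
    have hcol : γ *ᵥ v j = μ j • v j := by
      rw [← Matrix.toLin'_apply]
      exact (hv j).apply_eq_smul
    have h1 : (γ * (P : Matrix (Fin N) (Fin N) K)) i j = (γ *ᵥ v j) i := by
      simp only [Matrix.mul_apply, Matrix.mulVec, dotProduct, hP]
    rw [h1, hcol, Matrix.mul_diagonal, hP, Pi.smul_apply, smul_eq_mul, mul_comm]
  refine ⟨P, ?_⟩
  rw [← hγP, Matrix.mul_assoc, ← Units.val_mul, mul_inv_cancel, Units.val_one, Matrix.mul_one]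

/-! ## §2 The commutant of `P·diag(μ)·P⁻¹` is `P·Diag·P⁻¹` -/

/-- A matrix commuting with `diag(μ)`, `μ` injective, is diagonal. [cite: HornJohnson2013, Thm. 3.2.4.2] -/
theorem eq_diagonal_of_diagonal_mul_eq_mul_diagonal {μ : Fin N → K} (hinj : Function.Injective μ) {y : Matrix (Fin N) (Fin N) K}
    (h : diagonal μ * y = y * diagonal μ) : y = diagonal (fun i => y i i) := by
  ext i j
  by_cases hij : i = j
  · subst hij
    rw [diagonal_apply_eq]
  · have h1 := congrFun (congrFun h i) j
    rw [diagonal_mul, mul_diagonal] at h1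
    have h2 : (μ i - μ j) * y i j = 0 := by rw [sub_mul, h1, mul_comm (y i j), sub_self]
    rw [diagonal_apply_ne _ hij]
    rcases mul_eq_zero.1 h2 with h3 | h3
    · exact absurd (hinj (sub_eq_zero.1 h3)) hij
    · exact h3

/-- `P⁻¹ P = 1` on matrices. [cite: HornJohnson2013, Thm. 1.3.9] -/
theorem units_inv_mul_val (P : GL (Fin N) K) : ((P⁻¹ : GL (Fin N) K) : Matrix (Fin N) (Fin N) K) * (P : Matrix (Fin N) (Fin N) K) = 1 := by
  rw [← Units.val_mul, inv_mul_cancel, Units.val_one]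

/-- `P P⁻¹ = 1` on matrices. [cite: HornJohnson2013, Thm. 1.3.9] -/
theorem units_mul_inv_val (P : GL (Fin N) K) : (P : Matrix (Fin N) (Fin N) K) * ((P⁻¹ : GL (Fin N) K) : Matrix (Fin N) (Fin N) K) = 1 := by
  rw [← Units.val_mul, mul_inv_cancel, Units.val_one]

/-- **THE CARTAN ALGEBRA OF `γ = P·diag(μ)·P⁻¹` (`μ` injective) IS `P·Diag·P⁻¹`**: `x` commutes with `γ` iff `x = P·diag(d)·P⁻¹` for some `d` (★ `cartanAlgebra` = the commutant).
[cite: Rogawski1990, §3.6 p. 30] [cite: HornJohnson2013, Thm. 3.2.4.2] -/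
theorem mem_cartanAlgebra_conj_diagonal_iff {μ : Fin N → K} (hinj : Function.Injective μ) (P : GL (Fin N) K) (x : Matrix (Fin N) (Fin N) K) :
    x ∈ cartanAlgebra ((P : Matrix (Fin N) (Fin N) K) * diagonal μ * ((P⁻¹ : GL (Fin N) K) : Matrix (Fin N) (Fin N) K)) ↔
      ∃ d : Fin N → K, x = (P : Matrix (Fin N) (Fin N) K) * diagonal d * ((P⁻¹ : GL (Fin N) K) : Matrix (Fin N) (Fin N) K) := by
  have hPi := units_inv_mul_val P
  have hPm := units_mul_inv_val P
  rw [mem_cartanAlgebra_iff]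
  constructor
  · intro h
    -- `y := P⁻¹ x P` commutes with `diag(μ)`
    set y := ((P⁻¹ : GL (Fin N) K) : Matrix (Fin N) (Fin N) K) * x * (P : Matrix (Fin N) (Fin N) K) with hy
    have hxy : x = (P : Matrix (Fin N) (Fin N) K) * y * ((P⁻¹ : GL (Fin N) K) : Matrix (Fin N) (Fin N) K) := by
      rw [hy]
      simp only [Matrix.mul_assoc]
      rw [hPm, Matrix.mul_one, ← Matrix.mul_assoc, hPm, Matrix.one_mul]
    have hc : diagonal μ * y = y * diagonal μ := by
      have h' := h.eq
      rw [hxy] at h'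
      -- h' : (P y P⁻¹)(P D P⁻¹) = (P D P⁻¹)(P y P⁻¹); strip `P … P⁻¹`
      have h'' : (P : Matrix (Fin N) (Fin N) K) * (y * diagonal μ) * ((P⁻¹ : GL (Fin N) K) : Matrix (Fin N) (Fin N) K) =
          (P : Matrix (Fin N) (Fin N) K) * (diagonal μ * y) * ((P⁻¹ : GL (Fin N) K) : Matrix (Fin N) (Fin N) K) := by
        have e1 : (P : Matrix (Fin N) (Fin N) K) * y * ((P⁻¹ : GL (Fin N) K) : Matrix (Fin N) (Fin N) K) *
            ((P : Matrix (Fin N) (Fin N) K) * diagonal μ * ((P⁻¹ : GL (Fin N) K) : Matrix (Fin N) (Fin N) K)) =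
            (P : Matrix (Fin N) (Fin N) K) * (y * diagonal μ) * ((P⁻¹ : GL (Fin N) K) : Matrix (Fin N) (Fin N) K) := by
          simp only [Matrix.mul_assoc]
          rw [← Matrix.mul_assoc ((P⁻¹ : GL (Fin N) K) : Matrix (Fin N) (Fin N) K) (P : Matrix (Fin N) (Fin N) K), hPi, Matrix.one_mul]
        have e2 : (P : Matrix (Fin N) (Fin N) K) * diagonal μ * ((P⁻¹ : GL (Fin N) K) : Matrix (Fin N) (Fin N) K) *
            ((P : Matrix (Fin N) (Fin N) K) * y * ((P⁻¹ : GL (Fin N) K) : Matrix (Fin N) (Fin N) K)) =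
            (P : Matrix (Fin N) (Fin N) K) * (diagonal μ * y) * ((P⁻¹ : GL (Fin N) K) : Matrix (Fin N) (Fin N) K) := by
          simp only [Matrix.mul_assoc]
          rw [← Matrix.mul_assoc ((P⁻¹ : GL (Fin N) K) : Matrix (Fin N) (Fin N) K) (P : Matrix (Fin N) (Fin N) K), hPi, Matrix.one_mul]
        rw [← e1, ← e2, h']
      have h3 := congrArg (fun z => ((P⁻¹ : GL (Fin N) K) : Matrix (Fin N) (Fin N) K) * z * (P : Matrix (Fin N) (Fin N) K)) h''
      simp only [Matrix.mul_assoc] at h3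
      rw [hPi, Matrix.mul_one, Matrix.mul_one, ← Matrix.mul_assoc, ← Matrix.mul_assoc, hPi, Matrix.one_mul, ← Matrix.mul_assoc, hPi,
        Matrix.one_mul] at h3
      exact h3.symm
    refine ⟨fun i => y i i, ?_⟩
    rw [← eq_diagonal_of_diagonal_mul_eq_mul_diagonal hinj hc]
    exact hxy
  · rintro ⟨d, rfl⟩
    -- `(P d P⁻¹)(P μ P⁻¹) = P (d μ) P⁻¹ = P (μ d) P⁻¹ = (P μ P⁻¹)(P d P⁻¹)`
    have hdd : diagonal d * diagonal μ = diagonal μ * diagonal d := by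
      rw [diagonal_mul_diagonal, diagonal_mul_diagonal]
      congr 1
      funext i
      exact mul_comm _ _
    show _ * _ = _ * _
    calc (P : Matrix (Fin N) (Fin N) K) * diagonal d * ((P⁻¹ : GL (Fin N) K) : Matrix (Fin N) (Fin N) K) *
          ((P : Matrix (Fin N) (Fin N) K) * diagonal μ * ((P⁻¹ : GL (Fin N) K) : Matrix (Fin N) (Fin N) K))
        = (P : Matrix (Fin N) (Fin N) K) * (diagonal d * diagonal μ) * ((P⁻¹ : GL (Fin N) K) : Matrix (Fin N) (Fin N) K) := by
          simp only [Matrix.mul_assoc]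
          rw [← Matrix.mul_assoc ((P⁻¹ : GL (Fin N) K) : Matrix (Fin N) (Fin N) K) (P : Matrix (Fin N) (Fin N) K), hPi, Matrix.one_mul]
      _ = (P : Matrix (Fin N) (Fin N) K) * (diagonal μ * diagonal d) * ((P⁻¹ : GL (Fin N) K) : Matrix (Fin N) (Fin N) K) := by rw [hdd]
      _ = (P : Matrix (Fin N) (Fin N) K) * diagonal μ * ((P⁻¹ : GL (Fin N) K) : Matrix (Fin N) (Fin N) K) *
          ((P : Matrix (Fin N) (Fin N) K) * diagonal d * ((P⁻¹ : GL (Fin N) K) : Matrix (Fin N) (Fin N) K)) := by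
          simp only [Matrix.mul_assoc]
          rw [← Matrix.mul_assoc ((P⁻¹ : GL (Fin N) K) : Matrix (Fin N) (Fin N) K) (P : Matrix (Fin N) (Fin N) K), hPi, Matrix.one_mul]

/-- Conjugation by a frame is injective on diagonal data: `P·diag(d)·P⁻¹ = P·diag(d′)·P⁻¹ ⇒ d = d′`. [cite: HornJohnson2013, Thm. 1.3.9] -/
theorem conj_diagonal_injective (P : GL (Fin N) K) {d d' : Fin N → K}
    (h : (P : Matrix (Fin N) (Fin N) K) * diagonal d * ((P⁻¹ : GL (Fin N) K) : Matrix (Fin N) (Fin N) K) =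
      (P : Matrix (Fin N) (Fin N) K) * diagonal d' * ((P⁻¹ : GL (Fin N) K) : Matrix (Fin N) (Fin N) K)) : d = d' := by
  have hPi := units_inv_mul_val P
  have h3 := congrArg (fun z => ((P⁻¹ : GL (Fin N) K) : Matrix (Fin N) (Fin N) K) * z * (P : Matrix (Fin N) (Fin N) K)) h
  simp only [Matrix.mul_assoc] at h3
  rw [hPi, Matrix.mul_one, Matrix.mul_one, ← Matrix.mul_assoc, ← Matrix.mul_assoc, hPi, Matrix.one_mul, Matrix.one_mul] at h3
  exact diagonal_injective h3

/-- `det(P·diag(d)·P⁻¹) = ∏ᵢ dᵢ`. [cite: HornJohnson2013, Thm. 1.3.9] -/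
theorem det_conj_diagonal_eq_prod (P : GL (Fin N) K) (d : Fin N → K) :
    ((P : Matrix (Fin N) (Fin N) K) * diagonal d * ((P⁻¹ : GL (Fin N) K) : Matrix (Fin N) (Fin N) K)).det = ∏ i, d i := by
  rw [det_units_conj, det_diagonal]

/-! ## §3 For a unitary `γ` with norm-one distinct roots, the Gram matrix of an eigenframe is diagonal -/

variable (σ : K →+* K) (H : Matrix (Fin N) (Fin N) K)

/-- **The Gram matrix `Q = ᵗσ(P)·H·P` of an eigenframe of a UNITARY `γ = P·diag(μ)·P⁻¹` with `σ(μᵢ)μᵢ = 1`, `μ` injective, has vanishing off-diagonal entries** — unitarity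
`ᵗσ(γ) H γ = H` reads `diag(σμ)·Q·diag(μ) = Q`, i.e. `Q_{ij}·(1 − σ(μ_i)μ_j) = 0`, and `σ(μ_i)μ_j = μ_j μ_i⁻¹ ≠ 1` for `i ≠ j` (the eigenlines of a unitary operator for distinct
norm-one eigenvalues are `H`-orthogonal). [cite: Rogawski1990, §3.6 p. 30] -/
theorem twistGram_eigenframe_apply_of_ne {γ : GL (Fin N) K} (hγ : γ ∈ unitaryGroup σ H) {μ : Fin N → K} (hinj : Function.Injective μ)
    (hμ : ∀ i, σ (μ i) * μ i = 1) (P : GL (Fin N) K)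
    (hP : (γ : Matrix (Fin N) (Fin N) K) = (P : Matrix (Fin N) (Fin N) K) * diagonal μ * ((P⁻¹ : GL (Fin N) K) : Matrix (Fin N) (Fin N) K))
    {i j : Fin N} (hij : i ≠ j) : twistGram σ H (P : Matrix (Fin N) (Fin N) K) i j = 0 := by
  have hPi := units_inv_mul_val P
  -- the frame read through `σ`: `R := ᵗσ(P)`, `R' := ᵗσ(P⁻¹)`, `R R' = 1`
  have hRR' : ((P : Matrix (Fin N) (Fin N) K).map σ)ᵀ * (((P⁻¹ : GL (Fin N) K) : Matrix (Fin N) (Fin N) K).map σ)ᵀ = 1 := by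
    rw [← transpose_mul, ← Matrix.map_mul, hPi, Matrix.map_one σ (map_zero σ) (map_one σ), transpose_one]
  -- unitarity, conjugated into the frame: `diag(σμ) Q diag(μ) = Q`
  have hu : (((γ : GL (Fin N) K) : Matrix (Fin N) (Fin N) K).map σ)ᵀ * H * ((γ : GL (Fin N) K) : Matrix (Fin N) (Fin N) K) = H := mem_unitaryGroup_iff.1 hγ
  rw [hP, Matrix.map_mul, Matrix.map_mul, transpose_mul, transpose_mul, diagonal_map (map_zero σ), diagonal_transpose] at hu
  have hQ : diagonal (fun i => σ (μ i)) * twistGram σ H (P : Matrix (Fin N) (Fin N) K) * diagonal μ = twistGram σ H (P : Matrix (Fin N) (Fin N) K) := by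
    have h1 := congrArg (fun z => ((P : Matrix (Fin N) (Fin N) K).map σ)ᵀ * z * (P : Matrix (Fin N) (Fin N) K)) hu
    simp only [Matrix.mul_assoc] at h1
    rw [hPi, Matrix.mul_one, ← Matrix.mul_assoc (((P : Matrix (Fin N) (Fin N) K).map σ)ᵀ) ((((P⁻¹ : GL (Fin N) K) : Matrix (Fin N) (Fin N) K).map σ)ᵀ),
      hRR', Matrix.one_mul] at h1
    -- h1 : diag(σμ) * (ᵗσ(P) * (H * (P * diag μ))) = ᵗσ(P) * (H * P)
    rw [twistGram_def]
    simp only [Matrix.mul_assoc]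
    exact h1
  have h2 := congrFun (congrFun hQ i) j
  rw [mul_diagonal, diagonal_mul] at h2
  -- `σ(μ i) * Q i j * μ j = Q i j` with `σ(μ i) μ j ≠ 1`
  have hμi : μ i ≠ 0 := fun h0 => by simpa [h0] using hμ i
  have hne : σ (μ i) * μ j ≠ 1 := by
    intro h1
    have : μ j = μ i := by
      have h3 : σ (μ i) * μ j = σ (μ i) * μ i := by rw [h1, hμ i]
      have hσi : σ (μ i) ≠ 0 := fun h0 => by simpa [h0] using hμ i
      exact mul_left_cancel₀ hσi h3
    exact hij (hinj this.symm)
  have h4 : (σ (μ i) * μ j - 1) * twistGram σ H (P : Matrix (Fin N) (Fin N) K) i j = 0 := by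
    rw [sub_mul, one_mul, sub_eq_zero]
    calc σ (μ i) * μ j * twistGram σ H (P : Matrix (Fin N) (Fin N) K) i j
        = σ (μ i) * twistGram σ H (P : Matrix (Fin N) (Fin N) K) i j * μ j := by ring
      _ = twistGram σ H (P : Matrix (Fin N) (Fin N) K) i j := h2
  rcases mul_eq_zero.1 h4 with h5 | h5
  · exact absurd (sub_eq_zero.1 h5) hne
  · exact h5

/-- **The Gram matrix of the eigenframe IS diagonal**: `ᵗσ(P)·H·P = diag(q)` with `q_i = (ᵗσ(P) H P)_{ii}`. [cite: Rogawski1990, §3.6 p. 30] -/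
theorem twistGram_eigenframe_eq_diagonal {γ : GL (Fin N) K} (hγ : γ ∈ unitaryGroup σ H) {μ : Fin N → K} (hinj : Function.Injective μ)
    (hμ : ∀ i, σ (μ i) * μ i = 1) (P : GL (Fin N) K)
    (hP : (γ : Matrix (Fin N) (Fin N) K) = (P : Matrix (Fin N) (Fin N) K) * diagonal μ * ((P⁻¹ : GL (Fin N) K) : Matrix (Fin N) (Fin N) K)) :
    twistGram σ H (P : Matrix (Fin N) (Fin N) K) = diagonal (fun i => twistGram σ H (P : Matrix (Fin N) (Fin N) K) i i) := by
  ext i j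
  by_cases hij : i = j
  · subst hij
    rw [diagonal_apply_eq]
  · rw [diagonal_apply_ne _ hij]
    exact twistGram_eigenframe_apply_of_ne σ H hγ hinj hμ P hP hij

/-- The diagonal Gram entries are `σ`-FIXED and NON-ZERO (`H` hermitian invertible, `σ` an involution): `q_i = h(v_i, v_i) ∈ K₀ˣ` — the LINE CLASSES of the frame.
[cite: Rogawski1990, §3.6 p. 30] -/
theorem twistGram_eigenframe_apply_self {γ : GL (Fin N) K} (hγ : γ ∈ unitaryGroup σ H) {μ : Fin N → K} (hinj : Function.Injective μ)
    (hμ : ∀ i, σ (μ i) * μ i = 1) (P : GL (Fin N) K)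
    (hP : (γ : Matrix (Fin N) (Fin N) K) = (P : Matrix (Fin N) (Fin N) K) * diagonal μ * ((P⁻¹ : GL (Fin N) K) : Matrix (Fin N) (Fin N) K))
    (hσ : ∀ r : K, σ (σ r) = r) (hHh : (H.map σ)ᵀ = H) (hH : IsUnit H.det) (i : Fin N) :
    σ (twistGram σ H (P : Matrix (Fin N) (Fin N) K) i i) = twistGram σ H (P : Matrix (Fin N) (Fin N) K) i i ∧
      twistGram σ H (P : Matrix (Fin N) (Fin N) K) i i ≠ 0 := by
  refine ⟨?_, ?_⟩
  · have h := conjTranspose_twistGram σ H hσ hHh (P : Matrix (Fin N) (Fin N) K)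
    have h1 := congrFun (congrFun h i) i
    rw [transpose_apply, map_apply] at h1
    exact h1
  · intro h0
    have hdet : (twistGram σ H (P : Matrix (Fin N) (Fin N) K)).det ≠ 0 := by
      have hmap : ((P : Matrix (Fin N) (Fin N) K).map σ).det = σ (P : Matrix (Fin N) (Fin N) K).det := by
        rw [← RingHom.mapMatrix_apply, RingHom.map_det]
      rw [twistGram_def, det_mul, det_mul, det_transpose, hmap]
      refine mul_ne_zero (mul_ne_zero ?_ hH.ne_zero) ?_
      · exact (map_ne_zero σ).2 (Matrix.isUnits_det_units P).ne_zero
      · exact (Matrix.isUnits_det_units P).ne_zero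
    rw [twistGram_eigenframe_eq_diagonal σ H hγ hinj hμ P hP, det_diagonal] at hdet
    exact hdet (Finset.prod_eq_zero (Finset.mem_univ i) h0)

/-! ## §4 The adjoint involution is `σ` on the coordinates -/

/-- **`(P·diag(d)·P⁻¹)⋆ = P·diag(σ ∘ d)·P⁻¹`** for an eigenframe `P` of a unitary `γ` with norm-one distinct roots (★ `hermStar σ H x = H⁻¹ ᵗσ(x) H`): with `R = ᵗσ(P)`,
`R′ = ᵗσ(P⁻¹)` and the diagonal Gram matrix `Q = R H P` one has `ᵗσ(x) H = R′·diag(σd)·Q·P⁻¹ = R′·Q·diag(σd)·P⁻¹ = H·(P·diag(σd)·P⁻¹)`.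
[cite: Rogawski1990, §3.5 Prop. 3.5.2 p. 29; §3.6 p. 30] -/
theorem hermStar_conj_diagonal {γ : GL (Fin N) K} (hγ : γ ∈ unitaryGroup σ H) {μ : Fin N → K} (hinj : Function.Injective μ)
    (hμ : ∀ i, σ (μ i) * μ i = 1) (P : GL (Fin N) K)
    (hP : (γ : Matrix (Fin N) (Fin N) K) = (P : Matrix (Fin N) (Fin N) K) * diagonal μ * ((P⁻¹ : GL (Fin N) K) : Matrix (Fin N) (Fin N) K))
    (hH : IsUnit H.det) (d : Fin N → K) :
    hermStar σ H ((P : Matrix (Fin N) (Fin N) K) * diagonal d * ((P⁻¹ : GL (Fin N) K) : Matrix (Fin N) (Fin N) K)) =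
      (P : Matrix (Fin N) (Fin N) K) * diagonal (fun i => σ (d i)) * ((P⁻¹ : GL (Fin N) K) : Matrix (Fin N) (Fin N) K) := by
  have hPi := units_inv_mul_val P
  have hPm := units_mul_inv_val P
  have hR'R : (((P⁻¹ : GL (Fin N) K) : Matrix (Fin N) (Fin N) K).map σ)ᵀ * ((P : Matrix (Fin N) (Fin N) K).map σ)ᵀ = 1 := by
    rw [← transpose_mul, ← Matrix.map_mul, hPm, Matrix.map_one σ (map_zero σ) (map_one σ), transpose_one]
  have hQd := twistGram_eigenframe_eq_diagonal σ H hγ hinj hμ P hP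
  set Q := twistGram σ H (P : Matrix (Fin N) (Fin N) K) with hQdef
  -- `R H = Q P⁻¹` and `H P = R' Q`
  have hRH : ((P : Matrix (Fin N) (Fin N) K).map σ)ᵀ * H = Q * ((P⁻¹ : GL (Fin N) K) : Matrix (Fin N) (Fin N) K) := by
    rw [hQdef, twistGram_def, Matrix.mul_assoc, Matrix.mul_assoc, hPm, Matrix.mul_one]
  have hHP : H * (P : Matrix (Fin N) (Fin N) K) = (((P⁻¹ : GL (Fin N) K) : Matrix (Fin N) (Fin N) K).map σ)ᵀ * Q := by
    rw [hQdef, twistGram_def, ← Matrix.mul_assoc, ← Matrix.mul_assoc, hR'R, Matrix.one_mul]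
  -- the key identity `ᵗσ(x) H = H y`
  have hkey : (((P : Matrix (Fin N) (Fin N) K) * diagonal d * ((P⁻¹ : GL (Fin N) K) : Matrix (Fin N) (Fin N) K)).map σ)ᵀ * H =
      H * ((P : Matrix (Fin N) (Fin N) K) * diagonal (fun i => σ (d i)) * ((P⁻¹ : GL (Fin N) K) : Matrix (Fin N) (Fin N) K)) := by
    rw [Matrix.map_mul, Matrix.map_mul, transpose_mul, transpose_mul, diagonal_map (map_zero σ), diagonal_transpose]
    calc (((P⁻¹ : GL (Fin N) K) : Matrix (Fin N) (Fin N) K).map σ)ᵀ * ((diagonal fun m => σ (d m)) * ((P : Matrix (Fin N) (Fin N) K).map σ)ᵀ) * H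
        = (((P⁻¹ : GL (Fin N) K) : Matrix (Fin N) (Fin N) K).map σ)ᵀ * (diagonal fun m => σ (d m)) * (((P : Matrix (Fin N) (Fin N) K).map σ)ᵀ * H) := by
          simp only [Matrix.mul_assoc]
      _ = (((P⁻¹ : GL (Fin N) K) : Matrix (Fin N) (Fin N) K).map σ)ᵀ * ((diagonal fun m => σ (d m)) * Q) * ((P⁻¹ : GL (Fin N) K) : Matrix (Fin N) (Fin N) K) := by
          rw [hRH]; simp only [Matrix.mul_assoc]
      _ = (((P⁻¹ : GL (Fin N) K) : Matrix (Fin N) (Fin N) K).map σ)ᵀ * (Q * (diagonal fun m => σ (d m))) * ((P⁻¹ : GL (Fin N) K) : Matrix (Fin N) (Fin N) K) := by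
          rw [hQd, diagonal_mul_diagonal, diagonal_mul_diagonal]
          congr 3
          funext m
          exact mul_comm _ _
      _ = H * (P : Matrix (Fin N) (Fin N) K) * (diagonal fun m => σ (d m)) * ((P⁻¹ : GL (Fin N) K) : Matrix (Fin N) (Fin N) K) := by
          rw [hHP]; simp only [Matrix.mul_assoc]
      _ = H * ((P : Matrix (Fin N) (Fin N) K) * (diagonal fun i => σ (d i)) * ((P⁻¹ : GL (Fin N) K) : Matrix (Fin N) (Fin N) K)) := by
          simp only [Matrix.mul_assoc]
  rw [hermStar_def, Matrix.mul_assoc, hkey, ← Matrix.mul_assoc, Matrix.nonsing_inv_mul H hH, Matrix.one_mul]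

/-! ## §5 `⋆`-fixed elements, `⋆`-norms and determinants in the frame -/

/-- **`⋆`-FIXED ⟺ `σ`-FIXED COORDINATES**: `(P·diag(d)·P⁻¹)⋆ = P·diag(d)·P⁻¹ ↔ ∀ i, σ(d_i) = d_i`. [cite: Rogawski1990, §3.5 Prop. 3.5.2 p. 29] -/
theorem hermStar_conj_diagonal_eq_self_iff {γ : GL (Fin N) K} (hγ : γ ∈ unitaryGroup σ H) {μ : Fin N → K} (hinj : Function.Injective μ)
    (hμ : ∀ i, σ (μ i) * μ i = 1) (P : GL (Fin N) K)
    (hP : (γ : Matrix (Fin N) (Fin N) K) = (P : Matrix (Fin N) (Fin N) K) * diagonal μ * ((P⁻¹ : GL (Fin N) K) : Matrix (Fin N) (Fin N) K))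
    (hH : IsUnit H.det) (d : Fin N → K) :
    hermStar σ H ((P : Matrix (Fin N) (Fin N) K) * diagonal d * ((P⁻¹ : GL (Fin N) K) : Matrix (Fin N) (Fin N) K)) =
        (P : Matrix (Fin N) (Fin N) K) * diagonal d * ((P⁻¹ : GL (Fin N) K) : Matrix (Fin N) (Fin N) K) ↔ ∀ i, σ (d i) = d i := by
  rw [hermStar_conj_diagonal σ H hγ hinj hμ P hP hH d]
  refine ⟨fun h => ?_, fun h => ?_⟩
  · have := conj_diagonal_injective P h
    exact fun i => congrFun this i
  · rw [show (fun i => σ (d i)) = d from funext h]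

/-- **`⋆`-NORMS ARE COORDINATEWISE NORMS**: for `t = P·diag(d)·P⁻¹`, `t⋆·t = P·diag(σ(d_i)·d_i)·P⁻¹`. [cite: Rogawski1990, §3.5 Prop. 3.5.2 p. 29] -/
theorem hermStar_mul_self_conj_diagonal {γ : GL (Fin N) K} (hγ : γ ∈ unitaryGroup σ H) {μ : Fin N → K} (hinj : Function.Injective μ)
    (hμ : ∀ i, σ (μ i) * μ i = 1) (P : GL (Fin N) K)
    (hP : (γ : Matrix (Fin N) (Fin N) K) = (P : Matrix (Fin N) (Fin N) K) * diagonal μ * ((P⁻¹ : GL (Fin N) K) : Matrix (Fin N) (Fin N) K))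
    (hH : IsUnit H.det) (d : Fin N → K) :
    hermStar σ H ((P : Matrix (Fin N) (Fin N) K) * diagonal d * ((P⁻¹ : GL (Fin N) K) : Matrix (Fin N) (Fin N) K)) *
        ((P : Matrix (Fin N) (Fin N) K) * diagonal d * ((P⁻¹ : GL (Fin N) K) : Matrix (Fin N) (Fin N) K)) =
      (P : Matrix (Fin N) (Fin N) K) * diagonal (fun i => σ (d i) * d i) * ((P⁻¹ : GL (Fin N) K) : Matrix (Fin N) (Fin N) K) := by
  have hPi := units_inv_mul_val P
  rw [hermStar_conj_diagonal σ H hγ hinj hμ P hP hH d]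
  calc (P : Matrix (Fin N) (Fin N) K) * (diagonal fun i => σ (d i)) * ((P⁻¹ : GL (Fin N) K) : Matrix (Fin N) (Fin N) K) *
        ((P : Matrix (Fin N) (Fin N) K) * diagonal d * ((P⁻¹ : GL (Fin N) K) : Matrix (Fin N) (Fin N) K))
      = (P : Matrix (Fin N) (Fin N) K) * ((diagonal fun i => σ (d i)) * diagonal d) * ((P⁻¹ : GL (Fin N) K) : Matrix (Fin N) (Fin N) K) := by
        simp only [Matrix.mul_assoc]
        rw [← Matrix.mul_assoc ((P⁻¹ : GL (Fin N) K) : Matrix (Fin N) (Fin N) K) (P : Matrix (Fin N) (Fin N) K), hPi, Matrix.one_mul]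
    _ = (P : Matrix (Fin N) (Fin N) K) * (diagonal fun i => σ (d i) * d i) * ((P⁻¹ : GL (Fin N) K) : Matrix (Fin N) (Fin N) K) := by
        rw [diagonal_mul_diagonal]

/-- **PACKAGE — THE SPLIT CARTAN ALGEBRA OF A TYPE-(1) ELEMENT**: for `γ ∈ U(H)(K)` (`H` invertible) whose characteristic polynomial is `∏ᵢ (X − μᵢ)` with `μ` injective and
`σ(μᵢ)μᵢ = 1`, there is a frame `P` with `γ = P·diag(μ)·P⁻¹`, `Z(γ) = P·Diag·P⁻¹`, `(P·diag(d)·P⁻¹)⋆ = P·diag(σd)·P⁻¹`, and a diagonal Gram matrix `ᵗσ(P) H P`.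
[cite: Rogawski1990, §3.6 p. 30; §3.5 Prop. 3.5.2 p. 29] -/
theorem exists_eigenframe_of_charpoly_eq_prod {γ : GL (Fin N) K} (hγ : γ ∈ unitaryGroup σ H) {μ : Fin N → K} (hinj : Function.Injective μ)
    (hμ : ∀ i, σ (μ i) * μ i = 1) (hχ : ((γ : GL (Fin N) K) : Matrix (Fin N) (Fin N) K).charpoly = ∏ i, (X - C (μ i))) (hH : IsUnit H.det) :
    ∃ P : GL (Fin N) K,
      (γ : Matrix (Fin N) (Fin N) K) = (P : Matrix (Fin N) (Fin N) K) * diagonal μ * ((P⁻¹ : GL (Fin N) K) : Matrix (Fin N) (Fin N) K) ∧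
      (∀ x : Matrix (Fin N) (Fin N) K, x ∈ cartanAlgebra ((γ : GL (Fin N) K) : Matrix (Fin N) (Fin N) K) ↔
        ∃ d : Fin N → K, x = (P : Matrix (Fin N) (Fin N) K) * diagonal d * ((P⁻¹ : GL (Fin N) K) : Matrix (Fin N) (Fin N) K)) ∧
      (∀ d : Fin N → K, hermStar σ H ((P : Matrix (Fin N) (Fin N) K) * diagonal d * ((P⁻¹ : GL (Fin N) K) : Matrix (Fin N) (Fin N) K)) =
        (P : Matrix (Fin N) (Fin N) K) * diagonal (fun i => σ (d i)) * ((P⁻¹ : GL (Fin N) K) : Matrix (Fin N) (Fin N) K)) ∧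
      twistGram σ H (P : Matrix (Fin N) (Fin N) K) = diagonal (fun i => twistGram σ H (P : Matrix (Fin N) (Fin N) K) i i) := by
  obtain ⟨P, hP⟩ := exists_units_conj_diagonal_of_charpoly_eq_prod ((γ : GL (Fin N) K) : Matrix (Fin N) (Fin N) K) μ hinj hχ
  refine ⟨P, hP, fun x => ?_, fun d => hermStar_conj_diagonal σ H hγ hinj hμ P hP hH d, twistGram_eigenframe_eq_diagonal σ H hγ hinj hμ P hP⟩
  conv_lhs => rw [hP]
  exact mem_cartanAlgebra_conj_diagonal_iff hinj P x

end Generic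

end Summit.HodgeConjecture.HodgeConjecture.R90.S4

end
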